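/-
Copyright (c) 2026 the pub-hodgecm-mathlib formalisation cell (harness21).  Prover seat hodgecm-mathlib-K2E1-p05 (g2), Track B ∕ K2-LIT (build stream 29),
h413 = `stmt-HodgeConjecture-24833`, line `K2_E1_TraceFormulaBeta`, live socket 5R `sig_K2E1GlobaliseSquareIntegrableU2R`, route S2 — (H2) DISCHARGE; dealer
K2E1-plan (g0) BY-NAME DEAL 2026-09-03T22:41:35Z, GO 22:44:25Z.
-/
import Summits.HodgeConjecture.HodgeConjecture.Theorems.K2E1PoincareSeriesCompactSupport   -- ★ p855192 (rung 1): `fiberIntegralVec` API, `P_φ(gH) = Σ' φ(g γ)`, continuity, `MemLp`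
import Summits.HodgeConjecture.HodgeConjecture.Theorems.K2E1PoincareSeriesConstantTerm    -- ★ p855202 (rung 2): §0 coset regrouping `tsum_eq_tsum_quotient_tsum_inv[_of_summable_norm]`
import Literature.NumberTheory.Automorphic.CuspidalSpectrumDiscrete                       -- ★ p855263: `ParabolicUnipotentData`, `ConstantTermVanishes`, `cuspForms`, `cuspidalSubspace`
import HarnessLib

/-!
# h413 ∕ Track B «K2-LIT», line `K2_E1_TraceFormulaBeta`, socket 5R — route S2, (H2) DISCHARGE `K2E1PoincareSeriesCuspidal`:
# THE POINCARÉ SERIES OF AN ADELICALLY CUSPIDAL TEST FUNCTION IS A CUSP FORM — `P_φ ∈ cuspForms`, `[P_φ] ∈ L²_cusp`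
(Gelfand–Graev–Piatetski-Shapiro (1969), Ch. 1 §4; Gelbart (1975), §9.B (9.40)–(9.45), Lemma 9.11; Godement–Jacquet (1972), §12; Borel–Jacquet (1979), §4.4–4.6;
the step «`P_φ` is cuspidal» of the globalisation of a supercuspidal `ρ₀`, Rogawski (1990), §13.8 p. 218 (i)–(iii), Langlands (1980), p. 227)

Cell `pub/hodgecm-mathlib`, crux H413 = `stmt-HodgeConjecture-24833`, route of record `HCCMUnconditional`; chair K2-lead (g0), dealer K2E1-plan (g0) 22:41:35Z («(H2) DISCHARGE: for
`F := P(e_v ⊗ 𝟙_{K^v})` prove `F ∈ cuspidalSubspace μH (cmParabolicData L 2)` from ★ rung 2 + the local→adelic glue; say exactly what you posit»), GO 22:44:25Z on the SHAPE 22:44:13Z.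
THEOREMS ONLY (no `def`, no instance, no notation, no named-fact `def`, no `sorry`); lane `--supports stmt-HodgeConjecture-24833 --as helper`.

THE GENERIC LAYER (this file; nothing posited).  `𝒢` an adelic group datum (★ `AdelicGroupData`) with `A_G = 1` and `G(K)` discrete, `𝔓` ANY family of unipotent radicals
(★ `ParabolicUnipotentData`: subgroups `N_i(𝔸) ≤ G(𝔸)` with rational points `N_i(K) = N_i(𝔸) ∩ G(K)`), `φ ∈ C_c(G(𝔸))`, `P_φ(gH) = Σ'_{γ ∈ G(K)} φ(g γ)` its Poincaré series
(★ rung 1 `fiberIntegralVec 𝒢.quotientSubgroup count φ`).  HYPOTHESES: **(A) ADELIC CUSPIDALITY of `φ` along each radical** — for every Haar measure `ν` on `N_i(𝔸)` and all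
`x, y ∈ G(𝔸)`, `∫_{N_i(𝔸)} φ(x u⁻¹ y) dν(u) = 0`; **(B) FINITE COVOLUME** — every fundamental domain of `N_i(K)` in `N_i(𝔸)` has finite Haar measure (`N_i(K)\N_i(𝔸)` compact for
genuine unipotent radicals; for ★ `cmParabolicData L 2` it is the compactness of `L⁺\𝔸_{L⁺}`).  CONCLUSION: `P_φ ∈ cuspForms μ 𝔓` (★ p855263: continuous, `L²`, ALL constant terms
vanish in ★'s convention `∫_𝓕 P_φ(x u⁻¹) dν(u) = 0` for every Haar `ν` on `↥N_i` and every LEFT fundamental domain `𝓕` of `N_i(K)`) and `[P_φ] ∈ L²_cusp(𝔓)` (★ `cuspidalSubspace`).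
Proof = the UNFOLDING of rung 2 re-run in ★'s subgroup ∕ left-action ∕ `u⁻¹` conventions: `∫_𝓕 Σ_{γ ∈ Γ} φ(x u⁻¹ γ) dν(u) = Σ_{q ∈ Γ∕N(K)} Σ_{η ∈ N(K)} ∫_𝓕 φ(x (η u)⁻¹ q̃⁻¹) dν(u)
= Σ_q ∫_{N(𝔸)} φ(x u⁻¹ q̃⁻¹) dν(u) = 0` (regrouping ★ rung 2 §0; Mathlib `IsFundamentalDomain.[l]integral_eq_tsum''`; absolute convergence from `P_{|φ|}` bounded (continuous with compact
support on the quotient, ★ rung 1) × (B)).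

* §1 (any topological group `G`, subgroup `N ≤ G` with a left fundamental domain `𝓕` of `Λ ≤ N`, countable `Γ ≤ G` containing `Λ`): `setLIntegral_tsum_inv_eq_tsum_lintegral` ([0, ∞]
  unfolding), `setIntegral_tsum_inv_eq_tsum_integral` (Bochner), **`setIntegral_tsum_inv_eq_zero_of_forall_integral_eq_zero`** (vanishing).
* §2 (adelic reading): **`constantTermVanishes_poincare`** — (A)+(B) ⇒ ★ `ConstantTermVanishes 𝔓 P_φ i`; **`poincare_mem_cuspForms`**, **`toLp_poincare_mem_cuspidalSubspace`** — the docking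
  head for ★ p855363 ED. 2 (`F := (h).toLp (fiberIntegralVec 𝒢.quotientSubgroup Measure.count φ)`, the (H1) vector of K2E1-p07 (g2)).
NOT HERE (§2 GLUE, next file `K2E1PureTensorAdelicCuspidal`): (A) for a PURE TENSOR `φ = e_v ⊗ ψ` from the LOCAL `N_v`-cuspidality of `e_v` (★ p855253 + ★ p855328 + K2E1-p04's `Nj`) under
the posited Weil unfolding (W_v) of `N_i(𝔸)` along its `v`-component; (B) for `cmParabolicData L 2` from adelic cocompactness.

HONEST LABEL.  Generic bookkeeping over ★ vocabulary; closes no socket; 5R stays LIVE; HC_CM is proved only modulo the 7 printed citations (2 remaining named inputs: hLiu418 =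
`stmt-HodgeConjecture-24832`, h413 = `stmt-HodgeConjecture-24833`) until rung 0 closes.

## References
* [GelfandGraevPiatetskiShapiro1969] I. M. Gelfand, M. I. Graev, I. I. Piatetski-Shapiro, *Representation theory and automorphic functions* (1969), Ch. 1 §4.
* [Gelbart1975] S. Gelbart, *Automorphic forms on adele groups*, Ann. of Math. Stud. 83 (1975), §9.B (9.40)–(9.45), Lemma 9.11.
* [GodementJacquet1972] R. Godement, H. Jacquet, *Zeta functions of simple algebras*, LNM 260 (1972), §12.
* [BorelJacquet1979] A. Borel, H. Jacquet, *Automorphic forms and automorphic representations*, PSPM 33.1 (1979), §4.4–4.6.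
* [Rogawski1990] J. D. Rogawski, *Automorphic Representations of Unitary Groups in Three Variables*, Ann. of Math. Stud. 123 (1990), §13.8 p. 218 (i)–(iii).
* [MoeglinWaldspurger1995] C. Moeglin, J.-L. Waldspurger, *Spectral decomposition and Eisenstein series* (1995), I.2.6.
-/

set_option autoImplicit false
-- the mandated namespace repeats `HodgeConjecture.HodgeConjecture`, as in every `Theorems/*.lean` of this sub-problem
set_option linter.dupNamespace false

noncomputable section

open MeasureTheory Measure Set Filter Function Topology CompactlySupported
open scoped ENNReal NNReal Pointwise
open Literature.NumberTheory.Automorphic Literature.MeasureTheory.Group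
open Summit.HodgeConjecture.HodgeConjecture.Cruxes.H413.K2E1PoincareSeriesConstantTerm (tsum_eq_tsum_quotient_tsum_inv tsum_eq_tsum_quotient_tsum_inv_of_summable_norm)
open Summit.HodgeConjecture.HodgeConjecture.Cruxes.H413.K2E1PoincareSeriesCompactSupport

universe u

namespace Summit.HodgeConjecture.HodgeConjecture.Cruxes.H413.K2E1PoincareSeriesCuspidal

/-! ## §1 Unfolding `∫_𝓕 Σ_{γ ∈ Γ} φ(x u⁻¹ γ) dν(u)` along a subgroup `N ≤ G` against a LEFT fundamental domain of `Λ ≤ N` (★ p855263's convention) -/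

section Cosets

variable {G : Type*} [Group G] (N : Subgroup G) (Λ : Subgroup N) (Γ : Subgroup G)

/-- The image `Λ_Γ ≤ Γ` of `Λ ≤ N` inside the countable `Γ ≤ G`, when `Λ ⊆ Γ` (for ★ `ParabolicUnipotentData`: `N_i(K) ≤ G(K)`), realised as the subtype
`{γ : Γ // ↑γ ∈ (Λ : Set N) mapped to G}`; we only use the bijection `Λ ≃ Λ_Γ`.  Here: `Λ_Γ := (Λ.map N.subtype).subgroupOf Γ`. [folklore] -/
theorem mem_map_subtype_iff {γ : G} : γ ∈ Λ.map N.subtype ↔ ∃ η : N, η ∈ Λ ∧ (η : G) = γ := by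
  constructor
  · rintro ⟨η, hη, rfl⟩
    exact ⟨η, hη, rfl⟩
  · rintro ⟨η, hη, rfl⟩
    exact ⟨η, hη, rfl⟩

/-- **The bijection `Λ ≃ Λ_Γ = (Λ.map N.subtype).subgroupOf Γ`** (for `Λ ⊆ Γ`): `λ ↦ ⟨⟨λ, _⟩, _⟩`. [folklore] -/
theorem bijective_toSubgroupOf (hΛ : ∀ η : N, η ∈ Λ → (η : G) ∈ Γ) :
    Function.Bijective fun l : Λ => (⟨⟨((l : N) : G), hΛ l l.2⟩, ⟨l, l.2, rfl⟩⟩ : (Λ.map N.subtype).subgroupOf Γ) := by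
  constructor
  · intro a b h
    have h1 := congrArg (fun z : (Λ.map N.subtype).subgroupOf Γ => ((z : Γ) : G)) h
    exact Subtype.ext (Subtype.ext h1)
  · rintro ⟨⟨γ, hγ⟩, hmem⟩
    obtain ⟨η, hη, hηγ⟩ := (mem_map_subtype_iff N Λ).1 (Subgroup.mem_subgroupOf.1 hmem)
    exact ⟨⟨η, hη⟩, Subtype.ext (Subtype.ext hηγ)⟩

/-- **Re-indexing the inner sum over `Λ`**: for `δ ∈ G` and `T : G → X` (`X = [0, ∞]` or a Banach space),
`Σ'_{η ∈ Λ_Γ} T (x u⁻¹ η⁻¹ δ) = Σ'_{λ ∈ Λ} T (x (λ • u)⁻¹ δ)` (`λ • u = λ u`, `(λ u)⁻¹ = u⁻¹ λ⁻¹`). [folklore] -/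
theorem tsum_subgroupOf_eq_tsum_smul {X : Type*} [AddCommMonoid X] [TopologicalSpace X] (hΛ : ∀ η : N, η ∈ Λ → (η : G) ∈ Γ) (T : G → X)
    (x δ : G) (w : N) :
    ∑' η : (Λ.map N.subtype).subgroupOf Γ, T (x * (w : G)⁻¹ * ((η : Γ) : G)⁻¹ * δ) = ∑' l : Λ, T (x * ((l • w : N) : G)⁻¹ * δ) := by
  rw [← (Equiv.ofBijective _ (bijective_toSubgroupOf N Λ Γ hΛ)).tsum_eq]
  refine tsum_congr fun l => ?_
  have h : ((l • w : N) : G) = ((l : N) : G) * (w : G) := by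
    rw [Subgroup.smul_def, smul_eq_mul, Subgroup.coe_mul]
  rw [h, mul_inv_rev, ← mul_assoc]
  rfl

end Cosets

section Unfolding

variable {G : Type*} [Group G] [TopologicalSpace G] [IsTopologicalGroup G] [MeasurableSpace G] [BorelSpace G]
  (N : Subgroup G) [MeasurableSpace N] [BorelSpace N] (Λ : Subgroup N) (Γ : Subgroup G) [Countable Γ]
  (ν : Measure N) [SMulInvariantMeasure Λ N ν] {𝓕 : Set N}

/-- **UNFOLDING in `[0, ∞]`: `∫⁻_𝓕 Σ'_{γ ∈ Γ} F(x u⁻¹ γ) dν(u) = Σ'_{q ∈ Γ∕Λ_Γ} ∫⁻_{N} F(x u⁻¹ q̃⁻¹) dν(u)`** for measurable `F : G → [0, ∞]`, `Γ ≤ G` countable, `Λ ≤ N` with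
`Λ ⊆ Γ` acting on `(N, ν)` by LEFT translation with fundamental domain `𝓕` — Tonelli, unconditional (★ rung 2's `setLIntegral_tsum_eq_tsum_lintegral` in the subgroup ∕ left ∕ `u⁻¹` convention).
[cite: Gelbart1975, §9.B (9.40)–(9.45), Lemma 9.11] [cite: GodementJacquet1972, §12] -/
theorem setLIntegral_tsum_inv_eq_tsum_lintegral (hΛ : ∀ η : N, η ∈ Λ → (η : G) ∈ Γ) (h𝓕 : IsFundamentalDomain Λ 𝓕 ν) {F : G → ℝ≥0∞} (hF : Measurable F)
    (x : G) :
    ∫⁻ u in 𝓕, ∑' γ : Γ, F (x * (u : G)⁻¹ * γ) ∂ν =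
      ∑' q : Γ ⧸ (Λ.map N.subtype).subgroupOf Γ, ∫⁻ u, F (x * (u : G)⁻¹ * ((q.out : Γ) : G)⁻¹) ∂ν := by
  haveI : Countable Λ := (bijective_toSubgroupOf N Λ Γ hΛ).1.countable
  haveI : Countable (Γ ⧸ (Λ.map N.subtype).subgroupOf Γ) := QuotientGroup.mk_surjective.countable
  have hpt : ∀ u : N, ∑' γ : Γ, F (x * (u : G)⁻¹ * γ) =
      ∑' q : Γ ⧸ (Λ.map N.subtype).subgroupOf Γ, ∑' l : Λ, F (x * ((l • u : N) : G)⁻¹ * ((q.out : Γ) : G)⁻¹) := by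
    intro u
    rw [tsum_eq_tsum_quotient_tsum_inv ((Λ.map N.subtype).subgroupOf Γ) (fun γ : Γ => F (x * (u : G)⁻¹ * γ))]
    refine tsum_congr fun q => ?_
    have h := tsum_subgroupOf_eq_tsum_smul N Λ Γ hΛ F x ((q.out : Γ) : G)⁻¹ u
    simp only [Subgroup.coe_mul, mul_inv_rev, ← mul_assoc] at h ⊢
    exact h
  simp_rw [hpt]
  have hmeasT : ∀ δ : G, Measurable fun u : N => F (x * (u : G)⁻¹ * δ) := fun δ =>
    hF.comp (((continuous_subtype_val.measurable).inv.const_mul x).mul_const δ)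
  have hmeas : ∀ (q : Γ ⧸ (Λ.map N.subtype).subgroupOf Γ) (l : Λ), Measurable fun u : N => F (x * ((l • u : N) : G)⁻¹ * ((q.out : Γ) : G)⁻¹) :=
    fun q l => (hmeasT _).comp (measurable_const_smul l)
  rw [lintegral_tsum fun q => (Measurable.tsum (hmeas q)).aemeasurable]
  refine tsum_congr fun q => ?_
  rw [lintegral_tsum fun l => (hmeas q l).aemeasurable]
  exact (h𝓕.lintegral_eq_tsum'' fun u : N => F (x * (u : G)⁻¹ * ((q.out : Γ) : G)⁻¹)).symm

variable {φ : G → ℂ}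

omit [Countable Γ] [SMulInvariantMeasure Λ N ν] in
/-- Each translate `u ↦ φ(x u⁻¹ δ)` of a measurable `φ` is measurable on `N`. [folklore] -/
theorem measurable_translate_inv (hφ : Measurable φ) (x δ : G) : Measurable fun u : N => φ (x * (u : G)⁻¹ * δ) :=
  hφ.comp (((continuous_subtype_val.measurable).inv.const_mul x).mul_const δ)

/-- **Each unfolded term is integrable** under `∫⁻_𝓕 Σ'_γ ‖φ(x u⁻¹ γ)‖ dν < ∞`. [cite: Gelbart1975, §9.B Lemma 9.11] -/
theorem integrable_unfoldedTerm_inv (hΛ : ∀ η : N, η ∈ Λ → (η : G) ∈ Γ) (hφ : Measurable φ) (x : G) (h𝓕 : IsFundamentalDomain Λ 𝓕 ν)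
    (hfin : ∫⁻ u in 𝓕, ∑' γ : Γ, ‖φ (x * (u : G)⁻¹ * γ)‖ₑ ∂ν < ∞) (q : Γ ⧸ (Λ.map N.subtype).subgroupOf Γ) :
    Integrable (fun u : N => φ (x * (u : G)⁻¹ * ((q.out : Γ) : G)⁻¹)) ν := by
  refine ⟨(measurable_translate_inv N hφ x _).aestronglyMeasurable, ?_⟩
  have h := setLIntegral_tsum_inv_eq_tsum_lintegral N Λ Γ ν hΛ h𝓕 (F := fun g => ‖φ g‖ₑ) hφ.enorm x
  calc ∫⁻ u, ‖φ (x * (u : G)⁻¹ * ((q.out : Γ) : G)⁻¹)‖ₑ ∂ν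
      ≤ ∑' q' : Γ ⧸ (Λ.map N.subtype).subgroupOf Γ, ∫⁻ u, ‖φ (x * (u : G)⁻¹ * ((q'.out : Γ) : G)⁻¹)‖ₑ ∂ν :=
        ENNReal.le_tsum (f := fun q' : Γ ⧸ (Λ.map N.subtype).subgroupOf Γ => ∫⁻ u, ‖φ (x * (u : G)⁻¹ * ((q'.out : Γ) : G)⁻¹)‖ₑ ∂ν) q
    _ = ∫⁻ u in 𝓕, ∑' γ : Γ, ‖φ (x * (u : G)⁻¹ * γ)‖ₑ ∂ν := h.symm
    _ < ∞ := hfin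

omit [Countable Γ] [SMulInvariantMeasure Λ N ν] in
/-- Each summand `u ↦ φ(x u⁻¹ γ)` is integrable on the fundamental domain. [folklore] -/
theorem integrableOn_translate_inv (hφ : Measurable φ) (x : G) (hfin : ∫⁻ u in 𝓕, ∑' γ : Γ, ‖φ (x * (u : G)⁻¹ * γ)‖ₑ ∂ν < ∞) (γ : Γ) :
    IntegrableOn (fun u : N => φ (x * (u : G)⁻¹ * γ)) 𝓕 ν := by
  refine ⟨(measurable_translate_inv N hφ x _).aestronglyMeasurable, ?_⟩
  calc ∫⁻ u in 𝓕, ‖φ (x * (u : G)⁻¹ * γ)‖ₑ ∂ν ≤ ∫⁻ u in 𝓕, ∑' γ' : Γ, ‖φ (x * (u : G)⁻¹ * γ')‖ₑ ∂ν :=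
        lintegral_mono fun u => ENNReal.le_tsum (f := fun γ' : Γ => ‖φ (x * (u : G)⁻¹ * γ')‖ₑ) γ
    _ < ∞ := hfin

omit [SMulInvariantMeasure Λ N ν] in
/-- The series of `L¹(𝓕)`-norms of the summands converges. [folklore] -/
theorem summable_setIntegral_norm_translate_inv (hφ : Measurable φ) (x : G) (hfin : ∫⁻ u in 𝓕, ∑' γ : Γ, ‖φ (x * (u : G)⁻¹ * γ)‖ₑ ∂ν < ∞) :
    Summable fun γ : Γ => ∫ u in 𝓕, ‖φ (x * (u : G)⁻¹ * γ)‖ ∂ν := by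
  have heq : ∀ γ : Γ, ∫ u in 𝓕, ‖φ (x * (u : G)⁻¹ * γ)‖ ∂ν = (∫⁻ u in 𝓕, ‖φ (x * (u : G)⁻¹ * γ)‖ₑ ∂ν).toReal := fun γ =>
    integral_norm_eq_lintegral_enorm (measurable_translate_inv N hφ x _).aestronglyMeasurable
  simp_rw [heq]
  refine ENNReal.summable_toReal ?_
  rw [← lintegral_tsum fun γ => (measurable_translate_inv N hφ x _).enorm.aemeasurable]
  exact hfin.ne

omit [MeasurableSpace G] [BorelSpace G] in
/-- **One unfolded term, Bochner form**: `Σ'_{η ∈ Λ_Γ} ∫_𝓕 φ(x u⁻¹ η⁻¹ δ) dν(u) = ∫_N φ(x u⁻¹ δ) dν(u)` for `u ↦ φ(x u⁻¹ δ)` integrable (Mathlib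
`IsFundamentalDomain.integral_eq_tsum''` for the LEFT action of `Λ` on `N`). [cite: Gelbart1975, §9.B Lemma 9.11] -/
theorem tsum_setIntegral_translate_inv_eq_integral (hΛ : ∀ η : N, η ∈ Λ → (η : G) ∈ Γ) (x : G) (h𝓕 : IsFundamentalDomain Λ 𝓕 ν) (δ : G)
    (hint : Integrable (fun u : N => φ (x * (u : G)⁻¹ * δ)) ν) :
    ∑' η : (Λ.map N.subtype).subgroupOf Γ, ∫ u in 𝓕, φ (x * (u : G)⁻¹ * ((η : Γ) : G)⁻¹ * δ) ∂ν = ∫ u, φ (x * (u : G)⁻¹ * δ) ∂ν := by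
  haveI : Countable Λ := (bijective_toSubgroupOf N Λ Γ hΛ).1.countable
  rw [h𝓕.integral_eq_tsum'' (fun u : N => φ (x * (u : G)⁻¹ * δ)) hint, ← (Equiv.ofBijective _ (bijective_toSubgroupOf N Λ Γ hΛ)).tsum_eq]
  refine tsum_congr fun l => ?_
  have hfun : (fun u : N => φ (x * (u : G)⁻¹ * (((Equiv.ofBijective _ (bijective_toSubgroupOf N Λ Γ hΛ) l : (Λ.map N.subtype).subgroupOf Γ) : Γ) : G)⁻¹ * δ)) =
      fun u : N => φ (x * ((l • u : N) : G)⁻¹ * δ) := by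
    funext u
    have h : ((l • u : N) : G) = ((l : N) : G) * (u : G) := by
      rw [Subgroup.smul_def, smul_eq_mul, Subgroup.coe_mul]
    rw [h, mul_inv_rev, ← mul_assoc]
    rfl
  rw [hfun]

/-- **UNFOLDING, Bochner form: `∫_𝓕 Σ'_{γ ∈ Γ} φ(x u⁻¹ γ) dν(u) = Σ'_{q ∈ Γ∕Λ_Γ} ∫_N φ(x u⁻¹ q̃⁻¹) dν(u)`** for measurable `φ : G → ℂ` with
`∫⁻_𝓕 Σ'_γ ‖φ(x u⁻¹ γ)‖ dν < ∞` (★ rung 2's `setIntegral_tsum_eq_tsum_integral` in the subgroup ∕ left ∕ `u⁻¹` convention). [cite: Gelbart1975, §9.B (9.40)–(9.45), Lemma 9.11]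
[cite: GodementJacquet1972, §12] -/
theorem setIntegral_tsum_inv_eq_tsum_integral (hΛ : ∀ η : N, η ∈ Λ → (η : G) ∈ Γ) (hφ : Measurable φ) (x : G) (h𝓕 : IsFundamentalDomain Λ 𝓕 ν)
    (hfin : ∫⁻ u in 𝓕, ∑' γ : Γ, ‖φ (x * (u : G)⁻¹ * γ)‖ₑ ∂ν < ∞) :
    ∫ u in 𝓕, ∑' γ : Γ, φ (x * (u : G)⁻¹ * γ) ∂ν = ∑' q : Γ ⧸ (Λ.map N.subtype).subgroupOf Γ, ∫ u, φ (x * (u : G)⁻¹ * ((q.out : Γ) : G)⁻¹) ∂ν := by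
  -- integrate the `Γ`-series term by term on `𝓕`
  rw [← integral_tsum_of_summable_integral_norm (integrableOn_translate_inv N Γ ν hφ x hfin) (summable_setIntegral_norm_translate_inv N Γ ν hφ x hfin)]
  -- regroup the absolutely convergent series of integrals along the cosets of `Λ_Γ`
  rw [tsum_eq_tsum_quotient_tsum_inv_of_summable_norm ((Λ.map N.subtype).subgroupOf Γ) (fun γ : Γ => ∫ u in 𝓕, φ (x * (u : G)⁻¹ * γ) ∂ν)
    ((summable_setIntegral_norm_translate_inv N Γ ν hφ x hfin).of_nonneg_of_le (fun _ => norm_nonneg _) fun γ => norm_integral_le_integral_norm _)]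
  refine tsum_congr fun q => ?_
  -- one coset: `Σ_η ∫_𝓕 φ(x u⁻¹ (q̃ η)⁻¹) = ∫_N φ(x u⁻¹ q̃⁻¹) dν`
  have h := tsum_setIntegral_translate_inv_eq_integral N Λ Γ ν hΛ x h𝓕 ((q.out : Γ) : G)⁻¹ (integrable_unfoldedTerm_inv N Λ Γ ν hΛ hφ x h𝓕 hfin q)
  simp only [Subgroup.coe_mul, mul_inv_rev, ← mul_assoc] at h ⊢
  exact h

/-- **VANISHING: if `∫_N φ(x u⁻¹ y) dν(u) = 0` for all `y ∈ G`, the unfolded constant term `∫_𝓕 Σ'_{γ ∈ Γ} φ(x u⁻¹ γ) dν(u)` is `0`** (absolute convergence as above).  This is the step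
that makes the Poincaré series of an `N`-CUSPIDAL test function a cusp form. [cite: GelfandGraevPiatetskiShapiro1969, Ch. 1 §4] [cite: Gelbart1975, §9.B (9.40)–(9.45)] -/
theorem setIntegral_tsum_inv_eq_zero_of_forall_integral_eq_zero (hΛ : ∀ η : N, η ∈ Λ → (η : G) ∈ Γ) (hφ : Measurable φ) (x : G)
    (h𝓕 : IsFundamentalDomain Λ 𝓕 ν) (hfin : ∫⁻ u in 𝓕, ∑' γ : Γ, ‖φ (x * (u : G)⁻¹ * γ)‖ₑ ∂ν < ∞)
    (hcusp : ∀ y : G, ∫ u, φ (x * (u : G)⁻¹ * y) ∂ν = 0) :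
    ∫ u in 𝓕, ∑' γ : Γ, φ (x * (u : G)⁻¹ * γ) ∂ν = 0 := by
  rw [setIntegral_tsum_inv_eq_tsum_integral N Λ Γ ν hΛ hφ x h𝓕 hfin]
  exact (tsum_congr fun q => hcusp _).trans tsum_zero

end Unfolding

/-! ## §2 The adelic reading: `P_φ` is a CUSP FORM along every posited unipotent radical -/

section Adelic

variable {K : Type} [Field K] [NumberField K] (𝒢 : AdelicGroupData.{0} K)
  [LocallyCompactSpace 𝒢.Adelic] [SecondCountableTopology 𝒢.Adelic] [T2Space 𝒢.Adelic] [MeasurableSpace 𝒢.Adelic] [BorelSpace 𝒢.Adelic]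
  [hH : IsClosed (𝒢.quotientSubgroup : Set 𝒢.Adelic)]
  (μ : Measure 𝒢.automorphicQuotient) [𝒢.IsAutomorphicMeasure μ] (𝔓 : 𝒢.ParabolicUnipotentData)
  [(Measure.count : Measure 𝒢.quotientSubgroup).IsMulLeftInvariant] [SFinite (Measure.count : Measure 𝒢.quotientSubgroup)]
  [IsFiniteMeasureOnCompacts (Measure.count : Measure 𝒢.quotientSubgroup)]

/-- **THE CONSTANT TERMS OF THE POINCARÉ SERIES OF AN ADELICALLY CUSPIDAL TEST FUNCTION VANISH** (★ p855263's `ConstantTermVanishes`, token for token).  `𝒢` an adelic group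
datum with `A_G = ⊥` (`hc`) and `G(K)` discrete (`hdisc`, so `A_G · G(K)` is closed — carried as the binder `[IsClosed …]` of ★ rung 1), `G(𝔸_K)` locally compact second countable Hausdorff, Borel; `𝔓` ANY ★ `ParabolicUnipotentData`; `φ ∈ C_c(G(𝔸_K), ℂ)` with
**(A)** `∫_{N_i(𝔸)} φ(x u⁻¹ y) dν(u) = 0` for every Haar `ν` on `↥N_i` and all `x, y` and **(B)** every fundamental domain of `N_i(K)` in `(N_i(𝔸), ν)` has finite measure.  Then for every
`i`, the constant term of `P_φ = fiberIntegralVec 𝒢.quotientSubgroup count φ` (`P_φ(gH) = Σ'_{γ ∈ G(K)} φ(g γ)`, ★ rung 1) along `N_i` vanishes: `u ↦ P_φ(x u⁻¹ · G(K))` is integrable on `𝓕`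
(`P_φ` is bounded — continuous with compact support on the quotient, ★ rung 1 — and `ν 𝓕 < ∞`) with integral `Σ_{q ∈ G(K)∕N_i(K)} ∫_{N_i(𝔸)} φ(x u⁻¹ q̃⁻¹) dν(u) = 0` (§1).
[cite: GelfandGraevPiatetskiShapiro1969, Ch. 1 §4] [cite: Gelbart1975, §9.B (9.40)–(9.45), Lemma 9.11] [cite: BorelJacquet1979, §4.4] -/
theorem constantTermVanishes_poincare (hc : 𝒢.center' = ⊥) (hdisc : 𝒢.IsDiscreteRational) (φ : C_c(𝒢.Adelic, ℂ))
    (hcusp : ∀ (i : 𝔓.ι) [MeasurableSpace (𝔓.radical i)] [BorelSpace (𝔓.radical i)] (ν : Measure (𝔓.radical i)) [ν.IsHaarMeasure] (x y : 𝒢.Adelic),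
      ∫ u, φ (x * ((u : 𝔓.radical i) : 𝒢.Adelic)⁻¹ * y) ∂ν = 0)
    (hcov : ∀ (i : 𝔓.ι) [MeasurableSpace (𝔓.radical i)] [BorelSpace (𝔓.radical i)] (ν : Measure (𝔓.radical i)) [ν.IsHaarMeasure] (𝓕 : Set (𝔓.radical i)),
      IsFundamentalDomain (𝔓.rational i) 𝓕 ν → ν 𝓕 < ∞)
    (i : 𝔓.ι) :
    letI := 𝒢.measurableSpaceQuotientForm
    haveI := 𝒢.borelSpaceQuotientForm
    𝒢.ConstantTermVanishes 𝔓 (fiberIntegralVec 𝒢.quotientSubgroup (Measure.count : Measure 𝒢.quotientSubgroup) (⇑φ)) i := by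
  letI := 𝒢.measurableSpaceQuotientForm
  haveI := 𝒢.borelSpaceQuotientForm
  intro _ _ ν _ 𝓕 h𝓕 x
  haveI := discreteTopology_quotientSubgroup_of_center'_eq_bot 𝒢 hc hdisc
  haveI := countable_quotientSubgroup_of_center'_eq_bot 𝒢 hc hdisc
  -- the Poincaré series as a sum, and uniform bounds for it and for `P_{|φ|}` (continuous with compact support on the quotient)
  have hP : ∀ g : 𝒢.Adelic, fiberIntegralVec 𝒢.quotientSubgroup (Measure.count : Measure 𝒢.quotientSubgroup) (⇑φ) (𝒢.toAutomorphicQuotient g) =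
      ∑' γ : 𝒢.quotientSubgroup, φ (g * (γ : 𝒢.Adelic)) := fun g => fiberIntegralVec_quotientSubgroup_count_mk 𝒢 hc hdisc φ g
  have hPc : Continuous (fiberIntegralVec 𝒢.quotientSubgroup (Measure.count : Measure 𝒢.quotientSubgroup) (⇑φ)) :=
    continuous_fiberIntegralVec 𝒢.quotientSubgroup Measure.count φ.continuous φ.hasCompactSupport
  obtain ⟨M, hM⟩ := hPc.bounded_above_of_compact_support (hasCompactSupport_fiberIntegralVec 𝒢.quotientSubgroup Measure.count φ.hasCompactSupport)
  have hφn : Continuous fun g : 𝒢.Adelic => ‖φ g‖ := φ.continuous.norm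
  have hφns : HasCompactSupport fun g : 𝒢.Adelic => ‖φ g‖ := φ.hasCompactSupport.norm
  obtain ⟨M', hM'⟩ := (continuous_fiberIntegralVec 𝒢.quotientSubgroup Measure.count hφn hφns).bounded_above_of_compact_support
    (hasCompactSupport_fiberIntegralVec 𝒢.quotientSubgroup Measure.count hφns)
  have hsumm : ∀ g : 𝒢.Adelic, Summable fun γ : 𝒢.quotientSubgroup => ‖φ (g * (γ : 𝒢.Adelic))‖ := fun g =>
    summable_of_hasFiniteSupport ((finite_support_fiber 𝒢.quotientSubgroup φ.hasCompactSupport g).subset fun γ hγ => by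
      rwa [Function.mem_support, norm_ne_zero_iff] at hγ)
  have hbound : ∀ g : 𝒢.Adelic, ∑' γ : 𝒢.quotientSubgroup, ‖φ (g * (γ : 𝒢.Adelic))‖ ≤ M' := fun g => by
    have h1 := hM' (QuotientGroup.mk g)
    rw [fiberIntegralVec_count_mk 𝒢.quotientSubgroup hφns g, Real.norm_of_nonneg (tsum_nonneg fun _ => norm_nonneg _)] at h1
    exact h1
  have hν𝓕 : ν 𝓕 < ∞ := hcov i ν 𝓕 h𝓕
  refine ⟨?_, ?_⟩
  · -- `u ↦ P_φ(x u⁻¹ H)` is continuous and bounded by `M`, and `ν 𝓕 < ∞`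
    refine Measure.integrableOn_of_bounded hν𝓕.ne ?_ (M := M) (Eventually.of_forall fun u => hM _)
    exact ((hPc.comp 𝒢.continuous_toAutomorphicQuotient).comp (continuous_const.mul continuous_subtype_val.inv)).aestronglyMeasurable
  · -- the unfolding of §1
    have hfun : (fun u : 𝔓.radical i => fiberIntegralVec 𝒢.quotientSubgroup (Measure.count : Measure 𝒢.quotientSubgroup) (⇑φ)
        (𝒢.toAutomorphicQuotient (x * (u : 𝒢.Adelic)⁻¹))) =
        fun u : 𝔓.radical i => ∑' γ : 𝒢.quotientSubgroup, φ (x * (u : 𝒢.Adelic)⁻¹ * (γ : 𝒢.Adelic)) :=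
      funext fun u => hP _
    rw [hfun]
    refine setIntegral_tsum_inv_eq_zero_of_forall_integral_eq_zero (𝔓.radical i) (𝔓.rational i) 𝒢.quotientSubgroup ν
      (fun η hη => 𝔓.coe_mem_quotientSubgroup_of_mem_rational hη) φ.continuous.measurable x h𝓕 ?_ fun y => hcusp i ν x y
    -- absolute convergence: `Σ' ‖φ(x u⁻¹ γ)‖ ≤ M'` pointwise, `ν 𝓕 < ∞`
    have hpt : ∀ u : 𝔓.radical i, ∑' γ : 𝒢.quotientSubgroup, ‖φ (x * (u : 𝒢.Adelic)⁻¹ * (γ : 𝒢.Adelic))‖ₑ ≤ ENNReal.ofReal M' := fun u => by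
      have h := ENNReal.ofReal_tsum_of_nonneg (fun _ => norm_nonneg _) (hsumm (x * (u : 𝒢.Adelic)⁻¹))
      simp only [ofReal_norm] at h
      rw [← h]
      exact ENNReal.ofReal_le_ofReal (hbound _)
    calc ∫⁻ u in 𝓕, ∑' γ : 𝒢.quotientSubgroup, ‖φ (x * (u : 𝒢.Adelic)⁻¹ * (γ : 𝒢.Adelic))‖ₑ ∂ν ≤ ∫⁻ _ in 𝓕, ENNReal.ofReal M' ∂ν :=
          lintegral_mono fun u => hpt u
      _ = ENNReal.ofReal M' * ν 𝓕 := setLIntegral_const _ _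
      _ < ∞ := ENNReal.mul_lt_top ENNReal.ofReal_lt_top hν𝓕

/-- **`P_φ ∈ cuspForms μ 𝔓`**: the Poincaré series of an adelically cuspidal test function (hypotheses (A), (B) as above) is a continuous square-integrable CUSP FORM along `𝔓`
(continuity and `L²`: ★ rung 1; constant terms: `constantTermVanishes_poincare`). [cite: GelfandGraevPiatetskiShapiro1969, Ch. 1 §4] [cite: BorelJacquet1979, §4.4–4.6] -/
theorem poincare_mem_cuspForms (hc : 𝒢.center' = ⊥) (hdisc : 𝒢.IsDiscreteRational) (φ : C_c(𝒢.Adelic, ℂ))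
    (hcusp : ∀ (i : 𝔓.ι) [MeasurableSpace (𝔓.radical i)] [BorelSpace (𝔓.radical i)] (ν : Measure (𝔓.radical i)) [ν.IsHaarMeasure] (x y : 𝒢.Adelic),
      ∫ u, φ (x * ((u : 𝔓.radical i) : 𝒢.Adelic)⁻¹ * y) ∂ν = 0)
    (hcov : ∀ (i : 𝔓.ι) [MeasurableSpace (𝔓.radical i)] [BorelSpace (𝔓.radical i)] (ν : Measure (𝔓.radical i)) [ν.IsHaarMeasure] (𝓕 : Set (𝔓.radical i)),
      IsFundamentalDomain (𝔓.rational i) 𝓕 ν → ν 𝓕 < ∞) :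
    letI := 𝒢.measurableSpaceQuotientForm
    haveI := 𝒢.borelSpaceQuotientForm
    fiberIntegralVec 𝒢.quotientSubgroup (Measure.count : Measure 𝒢.quotientSubgroup) (⇑φ) ∈ 𝒢.cuspForms μ 𝔓 := by
  letI := 𝒢.measurableSpaceQuotientForm
  haveI := 𝒢.borelSpaceQuotientForm
  exact ⟨continuous_fiberIntegralVec_quotientSubgroup 𝒢 Measure.count φ, memLp_fiberIntegralVec_quotientSubgroup 𝒢 μ Measure.count φ 2,
    fun i => constantTermVanishes_poincare 𝒢 𝔓 hc hdisc φ hcusp hcov i⟩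

/-- **`[P_φ] ∈ L²_cusp(𝔓)`** — THE DOCKING HEAD FOR (H2): for every `L²` witness `h`, the class `h.toLp P_φ` of the Poincaré series lies in ★ `cuspidalSubspace μ 𝔓` (★
`toLp_mem_cuspidalSubspace`; the class does not depend on the witness).  With ★ p855363 `globaliseSupercuspidal_of_cuspidal` this is hypothesis (H2) for the (H1) vector
`F := (h).toLp (fiberIntegralVec 𝒢.quotientSubgroup Measure.count φ)` of K2E1-p07 (g2). [cite: BorelJacquet1979, §4.6] [cite: Rogawski1990, §13.8 p. 218 (i)–(iii)] -/
theorem toLp_poincare_mem_cuspidalSubspace (hc : 𝒢.center' = ⊥) (hdisc : 𝒢.IsDiscreteRational) (φ : C_c(𝒢.Adelic, ℂ))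
    (hcusp : ∀ (i : 𝔓.ι) [MeasurableSpace (𝔓.radical i)] [BorelSpace (𝔓.radical i)] (ν : Measure (𝔓.radical i)) [ν.IsHaarMeasure] (x y : 𝒢.Adelic),
      ∫ u, φ (x * ((u : 𝔓.radical i) : 𝒢.Adelic)⁻¹ * y) ∂ν = 0)
    (hcov : ∀ (i : 𝔓.ι) [MeasurableSpace (𝔓.radical i)] [BorelSpace (𝔓.radical i)] (ν : Measure (𝔓.radical i)) [ν.IsHaarMeasure] (𝓕 : Set (𝔓.radical i)),
      IsFundamentalDomain (𝔓.rational i) 𝓕 ν → ν 𝓕 < ∞) :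
    letI := 𝒢.measurableSpaceQuotientForm
    haveI := 𝒢.borelSpaceQuotientForm
    ∀ h : MemLp (fiberIntegralVec 𝒢.quotientSubgroup (Measure.count : Measure 𝒢.quotientSubgroup) (⇑φ) : 𝒢.automorphicQuotient → ℂ) 2 μ,
      h.toLp _ ∈ 𝒢.cuspidalSubspace μ 𝔓 := by
  letI := 𝒢.measurableSpaceQuotientForm
  haveI := 𝒢.borelSpaceQuotientForm
  intro h
  exact AdelicGroupData.toLp_mem_cuspidalSubspace (poincare_mem_cuspForms 𝒢 μ 𝔓 hc hdisc φ hcusp hcov)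

end Adelic

end Summit.HodgeConjecture.HodgeConjecture.Cruxes.H413.K2E1PoincareSeriesCuspidal

end
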